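import Summits.NavierStokesRegularity.NavierStokesRegularity.Theorems.IntenseSetDoorsDefs
import Literature.Analysis.FluidPDE.VorticitySupEnstrophyGronwallSharp
import Literature.Analysis.FluidPDE.ConstantinFeffermanStretching
import HarnessLib

/-!
# IntenseSetDoorsLowStretching — door family S34 «IntenseSetDoors» (nsreg-p1 ROUND-32, texts
# `Theorems/IntenseSetDoorsDefs.lean` = `r32/Sketch34.lean` c542dddc314f2f7c), plate V34

**`valueCutoffLowStretching_holds : ValueCutoffLowStretching`** — the LOW part of the engine shared by
doors A and B: for radii `0 < L < L'`, the stretching density weighted by the value cut-off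
`radialCutoff L L' (ω x)` (`∈ [0,1]`, `= 0` where `|ω| ≥ L'`) integrates to at most `(2/√3) L' ∫|∇v|²_F` —
Chae's pointwise strain algebra `two_mul_inner_curl_fderiv_le_of_divergence_eq_zero` with `Ω := L'` on the
support of the weight (`radialCutoff_eq_zero`), then monotonicity of the integral (the weighted density is
dominated by `(L'/2)(‖∇v‖² + |ω|²)`). Same count as the low piece of `twoThresholdStretching_holds` (S33 T33).

HONEST FRAME: S34 = three regularity CRITERIA on the scale-critical intense set, Type-II-inclusive; nothing
here bears on item 0056 `NoTypeII` or on NS regularity itself.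
-/

noncomputable section

set_option linter.dupNamespace false

namespace Summit.NavierStokesRegularity.NavierStokesRegularity.Theorems.IntenseSetDoors

open MeasureTheory Set Function Filter Metric Real InnerProductSpace
open _root_.Topology
open scoped ENNReal NNReal RealInnerProductSpace
open Literature.Analysis Literature.Analysis.FluidPDE

-- nested operator types (second derivatives)
set_option maxSynthPendingDepth 3

/-- **Plate V34 «ValueCutoffLowStretching»**: `2∫ θ_{L,L'}(ω)⟪ω,(∇v)ω⟫ ≤ (2/√3) L' ∫|∇v|²_F` for
`0 < L < L'` and every admissible divergence-free field (Chae 2005 pointwise bound under the value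
cut-off). [folklore] -/
theorem valueCutoffLowStretching_holds : ValueCutoffLowStretching := by
  intro L L' hL hLL' v hv hdiv _ hG _ _
  have hL'0 : 0 < L' := hL.trans hLL'
  -- basic objects
  have hv1 : ContDiff ℝ 1 v := hv.of_le (by norm_num)
  have hDv : Continuous (fderiv ℝ v) := hv.continuous_fderiv (by norm_num)
  have hω1 : ContDiff ℝ 1 (curl v) := contDiff_curl (n := 1) (by exact hv)
  have hωc : Continuous (curl v) := hω1.continuous
  have hωle : ∀ x, ‖curl v x‖ ≤ ‖curlCLM‖ * ‖fderiv ℝ v x‖ := fun x => norm_curl_le v x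
  have Iω : Integrable fun x => ‖curl v x‖ ^ 2 := by
    refine (hG.const_mul (‖curlCLM‖ ^ 2)).mono' ((hωc.norm.pow 2).aestronglyMeasurable)
      (Eventually.of_forall fun x => ?_)
    rw [Real.norm_of_nonneg (sq_nonneg _), ← mul_pow]
    exact pow_le_pow_left₀ (norm_nonneg _) (hωle x) 2
  have Ifv : Integrable fun x => frobeniusNormSq (fderiv ℝ v x) := by
    refine (hG.const_mul 3).mono' (continuous_frobeniusNormSq_fderiv hv (by norm_num)).aestronglyMeasurable
      (Eventually.of_forall fun x => ?_)
    rw [Real.norm_of_nonneg (frobeniusNormSq_nonneg _)]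
    exact frobeniusNormSq_le_three_mul _
  -- the weighted density and its pointwise bound
  set Lt : (EuclideanSpace ℝ (Fin 3)) → ℝ :=
    fun x => radialCutoff L L' (curl v x) * ⟪curl v x, fderiv ℝ v x (curl v x)⟫ with hLt
  have hθ01 : ∀ x, 0 ≤ radialCutoff L L' (curl v x) ∧ radialCutoff L L' (curl v x) ≤ 1 :=
    fun x => ⟨radialCutoff_nonneg _ _ _, radialCutoff_le_one _ _ _⟩
  have hθlt : ∀ x, radialCutoff L L' (curl v x) ≠ 0 → ‖curl v x‖ < L' := by
    intro x hx
    by_contra h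
    exact hx (radialCutoff_eq_zero hL.le hLL' (not_lt.1 h))
  have hLt_pt : ∀ x, 2 * Lt x ≤ 2 / Real.sqrt 3 * L' * frobeniusNormSq (fderiv ℝ v x) := by
    intro x
    have hrhs0 : 0 ≤ 2 / Real.sqrt 3 * L' * frobeniusNormSq (fderiv ℝ v x) := by
      have := frobeniusNormSq_nonneg (fderiv ℝ v x)
      positivity
    by_cases hθ : radialCutoff L L' (curl v x) = 0
    · have : Lt x = 0 := by
        show radialCutoff L L' (curl v x) * _ = 0
        rw [hθ, zero_mul]
      rw [this, mul_zero]; exact hrhs0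
    · have hchae := two_mul_inner_curl_fderiv_le_of_divergence_eq_zero (hdiv x) (hθlt x hθ).le
      obtain ⟨hw0, hw1⟩ := hθ01 x
      show 2 * (radialCutoff L L' (curl v x) * ⟪curl v x, fderiv ℝ v x (curl v x)⟫) ≤ _
      calc 2 * (radialCutoff L L' (curl v x) * ⟪curl v x, fderiv ℝ v x (curl v x)⟫)
          = radialCutoff L L' (curl v x) * (2 * ⟪curl v x, fderiv ℝ v x (curl v x)⟫) := by ring
        _ ≤ radialCutoff L L' (curl v x) * (2 / Real.sqrt 3 * L' * frobeniusNormSq (fderiv ℝ v x)) :=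
            mul_le_mul_of_nonneg_left hchae hw0
        _ ≤ 1 * (2 / Real.sqrt 3 * L' * frobeniusNormSq (fderiv ℝ v x)) :=
            mul_le_mul_of_nonneg_right hw1 hrhs0
        _ = _ := one_mul _
  -- integrability of the weighted density
  have hLt_abs : ∀ x, |Lt x| ≤ L' / 2 * (‖fderiv ℝ v x‖ ^ 2 + ‖curl v x‖ ^ 2) := by
    intro x
    by_cases hθ : radialCutoff L L' (curl v x) = 0
    · have : Lt x = 0 := by
        show radialCutoff L L' (curl v x) * _ = 0
        rw [hθ, zero_mul]
      rw [this, abs_zero]; positivity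
    · have hlt : ‖curl v x‖ < L' := hθlt x hθ
      obtain ⟨hw0, hw1⟩ := hθ01 x
      have hin : |⟪curl v x, fderiv ℝ v x (curl v x)⟫| ≤ ‖curl v x‖ * (‖fderiv ℝ v x‖ * ‖curl v x‖) :=
        (abs_real_inner_le_norm _ _).trans (mul_le_mul_of_nonneg_left
          (ContinuousLinearMap.le_opNorm _ _) (norm_nonneg _))
      show |radialCutoff L L' (curl v x) * ⟪curl v x, fderiv ℝ v x (curl v x)⟫| ≤ _
      rw [abs_mul, abs_of_nonneg hw0]
      calc radialCutoff L L' (curl v x) * |⟪curl v x, fderiv ℝ v x (curl v x)⟫|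
          ≤ 1 * (‖curl v x‖ * (‖fderiv ℝ v x‖ * ‖curl v x‖)) :=
            mul_le_mul hw1 hin (abs_nonneg _) zero_le_one
        _ ≤ L' * (‖fderiv ℝ v x‖ * ‖curl v x‖) := by
            rw [one_mul]
            exact mul_le_mul_of_nonneg_right hlt.le (by positivity)
        _ ≤ L' / 2 * (‖fderiv ℝ v x‖ ^ 2 + ‖curl v x‖ ^ 2) := by
            nlinarith [sq_nonneg (‖fderiv ℝ v x‖ - ‖curl v x‖), hL'0]
  have Idom : Integrable fun x => L' / 2 * (‖fderiv ℝ v x‖ ^ 2 + ‖curl v x‖ ^ 2) :=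
    (hG.add Iω).const_mul (L' / 2)
  have hθcont : Continuous fun x => radialCutoff L L' (curl v x) :=
    (radialCutoff_contDiff (E' := EuclideanSpace ℝ (Fin 3)) L L' (n := 1)).continuous.comp hωc
  have ILt : Integrable Lt := by
    have hcont : Continuous Lt := hθcont.mul (hωc.inner (hDv.clm_apply hωc))
    refine Idom.mono' hcont.aestronglyMeasurable (Eventually.of_forall fun x => ?_)
    rw [Real.norm_eq_abs]
    exact hLt_abs x
  -- integrate
  have h1 : ∫ x, 2 * Lt x ≤ ∫ x, 2 / Real.sqrt 3 * L' * frobeniusNormSq (fderiv ℝ v x) :=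
    integral_mono (ILt.const_mul 2) (Ifv.const_mul _) hLt_pt
  rw [integral_const_mul, integral_const_mul] at h1
  exact h1

end Summit.NavierStokesRegularity.NavierStokesRegularity.Theorems.IntenseSetDoors

end
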